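/-
Origin: written from primary sources — S. Kudla, *Seesaw dual reductive pairs* (1984) §1 (the see-saw pair
`(U(V) × U(V), U(W₁ ⊕ W₂)) ↔ (U(V), U(W₁) × U(W₂))` in `Sp(Res(V ⊗ (W₁ ⊕ W₂)))`); R. Howe, *θ-series and invariant
theory* (1979) §2–§3 (restriction of the oscillator representation to a see-saw partner is the tensor of the small
oscillator representations up to a character); S. Gelbart, J. Rogawski, Invent. Math. 105 (1991) §3.1 Prop. 3.1.1
p. 455 and Remark p. 457 (compatible splittings; two splittings differ by a character trivial on rational points);
A. Weil, Acta Math. 111 (1964) Chap. III n° 41 Thm 6 p. 193. Adapted: no. This file is the JUNCTION, at the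
splitting data OF RECORD (`UnitaryDualPairSplittingDatum`, `UnitaryDualPairThetaKernel`) of the three dual pairs
`(U(J_V), U(J₁ ⊕ᶠ J₂))`, `(U(J_V), U(J₁))`, `(U(J_V), U(J₂))`, of the abstract see-saw character
(`Weil1964/AdelicMetaplecticSeesawSum`) with unitary-2's adelic see-saw square
(`UnitaryGroupDirectSumCarriers.adelicPairToSymplectic_dualPair_adelicBlockDiag`). Kernel only; no records; the
compatibility of the three splittings ([GelbartRogawski1991, Prop. 3.1.1]) is a hypothesis, never asserted.
-/
import Literature.NumberTheory.GelbartRogawski1991.UnitaryDualPairThetaKernel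
import Literature.NumberTheory.Automorphic.UnitaryGroupDirectSumCarriers
import Literature.NumberTheory.Weil1964.AdelicMetaplecticSeesawSum
import HarnessLib

-- buildfix G11b-3 recipe (LEDGER B13-1/B13-3): elaborate sequentially so the trailing `attribute [implicit_reducible]`
-- block (reducibilityCoreExt is keyed to the async environment branch) is in force at `.olean` export.
set_option Elab.async false

/-!
# The `(12)` see-saw character of the unitary dual pairs `(U(V), U(W₁ ⊕ W₂))`, `(U(V), U(W_j))` at the
# splitting data of record

Setting (`UnitaryDualPairSplittingDatum`): a quadratic extension `E/F` of number fields, `c ∈ Gal(E/F)`, `δ ∈ E`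
with `c δ = -δ`, `δ² = d ∈ F`; hermitian Gram matrices `J_V = T_V ⊗ 1`, `J_j = T_j ⊗ 1` (`T_V ∈ GL_N(F)`,
`T_j ∈ GL_{M_j}(F)` symmetric), the plane `W = W₁ ⊕ W₂` with Gram `J₁ ⊕ᶠ J₂ = (T₁ ⊕ᶠ T₂) ⊗ 1` on `Fin (M₁ + M₂)`;
enumerations `e_W : Fin N × Fin (M₁ + M₂) ≃ Fin n`, `e_j : Fin N × Fin M_j ≃ Fin n_j`; and three homomorphisms
`s, s₁, s₂` into the metaplectic groups of record of `Res(V ⊗ W)`, `Res(V ⊗ W_j)` which are COMPATIBLE in the sense of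
[GelbartRogawski1991, Prop. 3.1.1] (hypotheses `hs`, `hs₁`, `hs₂ : (splittingDatum …).IsCompatible _`).

* §1 the three pair splittings read on the see-saw group `P = U(J_V)(𝔸) × (U(J₁)(𝔸) × U(J₂)(𝔸))` in KRONECKER
  coordinates: `seesawBig s : P →* Mp_ψ(W_{T_V ⊗ (T₁ ⊕ᶠ T₂)})ᶜᵒⁿᵗ` (`(g, (u₁, u₂)) ↦ s_pair(g, u₁ ⊕ᶠ u₂)` read back along
  `e_W`, `AdelicMetaplecticSeesawSum` §0), `seesawSmall₁ s₁`, `seesawSmall₂ s₂` (`(g, (u₁, u₂)) ↦ s_{j,pair}(g, u_j)` read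
  back along `e_j`); their projections are unitary-2's `adelicPairToSymplectic … (dualPair (g, ·))`
  (`proj_seesawBig`, `proj_seesawSmall₁/₂`), their values at rational points are `Θ`-fixing
  (`coe_seesawBig_mem_adelicMpTheta`, …), and their Weil operators are those of `s_pair` up to `R_{e}`
  (`omega_seesawBig_apply`, …);
* §2 **`hS_seesaw`**: the hypothesis `hS` of `mpSeesawCharSum` along `finProdSumEquiv N M₁ M₂` holds — it IS
  `adelicPairToSymplectic_dualPair_adelicBlockDiag` — whence **`mpSeesawChar₁₂ … s s₁ s₂ hs hs₁ hs₂ : P →* ℂˣ`** with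
  `ω(seesawBig s p) (sumTensor Φ₁ Φ₂) = χ(p) • sumTensor (ω(seesawSmall₁ s₁ p) Φ₁) (ω(seesawSmall₂ s₂ p) Φ₂)`
  (`mpSeesawChar₁₂_spec`), **`χ = 1` on `U(J_V)(F) × (U(J₁)(F) × U(J₂)(F))`** (`mpSeesawChar₁₂_eq_one_of_rational`:
  [GelbartRogawski1991, Remark p. 457] in kernel form — the three compatible splittings differ on the see-saw by an
  AUTOMORPHIC character), continuity along the continuity of the three pair splittings, and `mpSeesawChar₁₂_def` so that
  the scheme identities of `AdelicMetaplecticSeesawCharacter` (`mpSeesaw_tensorToSum_twist_small/_big`, the factor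
  characters `mpCharV/mpChar₁/mpChar₂`) apply verbatim.

Provenance / use (Hodge-CM model-construction cell, node W2-⊗, rows `gen12`/`real34` of the E term): this is the
`(12)` restriction identity `RestrictTmul` of the package's `ThetaSeesawData` for the CONSTRUCTED adelic Weil
representations, up to the character `χ` (absorbed by the λ-renormalisation of the small pairs,
`SeesawScalarCharacter` scheme small). The `(34)` torus is obtained by inserting
`AdelicMetaplecticSeesawConjugate.conjSplitting` (conjugation by Weil's rational lift of the isometry moving
`W₃ ⊕ W₄` to `W₁ ⊕ W₂`) between §1 and §2. What this file does NOT prove: `χ = 1` identically (that is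
[Kudla1994, Thm 3.1] / [HKS1996, Cor. A.3] for matched splitting characters — the splittings of record are chosen
only up to automorphic characters).
-/

set_option autoImplicit false

noncomputable section

open scoped Matrix Kronecker
open NumberField
open Literature.RepresentationTheory.HeisenbergGroup
open Literature.NumberTheory.Automorphic
open Literature.NumberTheory.Automorphic.UnitaryGroup
open Literature.NumberTheory.Weil1964

namespace Literature.NumberTheory.GelbartRogawski1991

namespace UnitaryDualPair

section Homs

variable (F E : Type) [Field F] [NumberField F] [Field E] [NumberField E] [Algebra F E]
variable (c : E ≃ₐ[F] E) (N M₁ M₂ : ℕ) {n n₁ n₂ : ℕ}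
  (eW : Fin N × Fin (M₁ + M₂) ≃ Fin n) (e₁ : Fin N × Fin M₁ ≃ Fin n₁) (e₂ : Fin N × Fin M₂ ≃ Fin n₂)
variable (JV : Matrix (Fin N) (Fin N) E) (J₁ : Matrix (Fin M₁) (Fin M₁) E) (J₂ : Matrix (Fin M₂) (Fin M₂) E)
variable {TV : Matrix (Fin N) (Fin N) F} {T₁ : Matrix (Fin M₁) (Fin M₁) F} {T₂ : Matrix (Fin M₂) (Fin M₂) F}

/-- **The big pair splitting on the see-saw group, Kronecker coordinates**:
`(g, (u₁, u₂)) ↦ reindex_{e_W}⁻¹ (s_pair(g, u₁ ⊕ᶠ u₂)) ∈ Mp_ψ(W_{T_V ⊗ (T₁ ⊕ᶠ T₂)})ᶜᵒⁿᵗ`. (cf. S. Kudla (1984) §1) [folklore] -/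
def seesawBig (s : adelicPair F E c N (M₁ + M₂) JV (finSum M₁ M₂ J₁ J₂) →*
      adelicMpCont F (Fin n) (adelicGram F eW TV (finSum M₁ M₂ T₁ T₂))) :
    adelic F E c N JV × (adelic F E c M₁ J₁ × adelic F E c M₂ J₂) →*
      adelicMpCont F (Fin N × Fin (M₁ + M₂))
        (TV.map (algebraMap F (AdeleRing (𝓞 F) F)) ⊗ₖ (finSum M₁ M₂ T₁ T₂).map (algebraMap F (AdeleRing (𝓞 F) F))) :=
  ((adelicMpContReindex F eW
      (TV.map (algebraMap F (AdeleRing (𝓞 F) F)) ⊗ₖ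
        (finSum M₁ M₂ T₁ T₂).map (algebraMap F (AdeleRing (𝓞 F) F)))).symm.toMonoidHom.comp
    (pairSplitting F E c N (M₁ + M₂) eW JV (finSum M₁ M₂ J₁ J₂) s)).comp
    ((MonoidHom.id (adelic F E c N JV)).prodMap (adelicBlockDiag F E c M₁ M₂ J₁ J₂))

/-- Unfolding. [folklore] -/
theorem seesawBig_apply (s : adelicPair F E c N (M₁ + M₂) JV (finSum M₁ M₂ J₁ J₂) →*
      adelicMpCont F (Fin n) (adelicGram F eW TV (finSum M₁ M₂ T₁ T₂)))
    (p : adelic F E c N JV × (adelic F E c M₁ J₁ × adelic F E c M₂ J₂)) :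
    seesawBig F E c N M₁ M₂ eW JV J₁ J₂ s p =
      (adelicMpContReindex F eW
        (TV.map (algebraMap F (AdeleRing (𝓞 F) F)) ⊗ₖ
          (finSum M₁ M₂ T₁ T₂).map (algebraMap F (AdeleRing (𝓞 F) F)))).symm
        (pairSplitting F E c N (M₁ + M₂) eW JV (finSum M₁ M₂ J₁ J₂) s (p.1, adelicBlockDiag F E c M₁ M₂ J₁ J₂ p.2)) :=
  rfl

/-- **The first small pair splitting on the see-saw group, Kronecker coordinates**:
`(g, (u₁, u₂)) ↦ reindex_{e₁}⁻¹ (s_{1,pair}(g, u₁))`. [folklore] -/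
def seesawSmall₁ (s₁ : adelicPair F E c N M₁ JV J₁ →* adelicMpCont F (Fin n₁) (adelicGram F e₁ TV T₁)) :
    adelic F E c N JV × (adelic F E c M₁ J₁ × adelic F E c M₂ J₂) →*
      adelicMpCont F (Fin N × Fin M₁)
        (TV.map (algebraMap F (AdeleRing (𝓞 F) F)) ⊗ₖ T₁.map (algebraMap F (AdeleRing (𝓞 F) F))) :=
  ((adelicMpContReindex F e₁
      (TV.map (algebraMap F (AdeleRing (𝓞 F) F)) ⊗ₖ T₁.map (algebraMap F (AdeleRing (𝓞 F) F)))).symm.toMonoidHom.comp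
    (pairSplitting F E c N M₁ e₁ JV J₁ s₁)).comp
    ((MonoidHom.id (adelic F E c N JV)).prodMap (MonoidHom.fst (adelic F E c M₁ J₁) (adelic F E c M₂ J₂)))

/-- Unfolding. [folklore] -/
theorem seesawSmall₁_apply (s₁ : adelicPair F E c N M₁ JV J₁ →* adelicMpCont F (Fin n₁) (adelicGram F e₁ TV T₁))
    (p : adelic F E c N JV × (adelic F E c M₁ J₁ × adelic F E c M₂ J₂)) :
    seesawSmall₁ F E c N M₁ M₂ e₁ JV J₁ J₂ s₁ p =
      (adelicMpContReindex F e₁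
        (TV.map (algebraMap F (AdeleRing (𝓞 F) F)) ⊗ₖ T₁.map (algebraMap F (AdeleRing (𝓞 F) F)))).symm
        (pairSplitting F E c N M₁ e₁ JV J₁ s₁ (p.1, p.2.1)) :=
  rfl

/-- **The second small pair splitting on the see-saw group, Kronecker coordinates**:
`(g, (u₁, u₂)) ↦ reindex_{e₂}⁻¹ (s_{2,pair}(g, u₂))`. [folklore] -/
def seesawSmall₂ (s₂ : adelicPair F E c N M₂ JV J₂ →* adelicMpCont F (Fin n₂) (adelicGram F e₂ TV T₂)) :
    adelic F E c N JV × (adelic F E c M₁ J₁ × adelic F E c M₂ J₂) →*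
      adelicMpCont F (Fin N × Fin M₂)
        (TV.map (algebraMap F (AdeleRing (𝓞 F) F)) ⊗ₖ T₂.map (algebraMap F (AdeleRing (𝓞 F) F))) :=
  ((adelicMpContReindex F e₂
      (TV.map (algebraMap F (AdeleRing (𝓞 F) F)) ⊗ₖ T₂.map (algebraMap F (AdeleRing (𝓞 F) F)))).symm.toMonoidHom.comp
    (pairSplitting F E c N M₂ e₂ JV J₂ s₂)).comp
    ((MonoidHom.id (adelic F E c N JV)).prodMap (MonoidHom.snd (adelic F E c M₁ J₁) (adelic F E c M₂ J₂)))

/-- Unfolding. [folklore] -/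
theorem seesawSmall₂_apply (s₂ : adelicPair F E c N M₂ JV J₂ →* adelicMpCont F (Fin n₂) (adelicGram F e₂ TV T₂))
    (p : adelic F E c N JV × (adelic F E c M₁ J₁ × adelic F E c M₂ J₂)) :
    seesawSmall₂ F E c N M₁ M₂ e₂ JV J₁ J₂ s₂ p =
      (adelicMpContReindex F e₂
        (TV.map (algebraMap F (AdeleRing (𝓞 F) F)) ⊗ₖ T₂.map (algebraMap F (AdeleRing (𝓞 F) F)))).symm
        (pairSplitting F E c N M₂ e₂ JV J₂ s₂ (p.1, p.2.2)) :=
  rfl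

/-! ### Weil operators (read back along the enumerations) -/

/-- `ω(seesawBig s p) Φ = R_{e_W}⁻¹ (ω(s_pair(g, u₁ ⊕ᶠ u₂)) (R_{e_W} Φ))`. [folklore] -/
theorem omega_seesawBig_apply (s : adelicPair F E c N (M₁ + M₂) JV (finSum M₁ M₂ J₁ J₂) →*
      adelicMpCont F (Fin n) (adelicGram F eW TV (finSum M₁ M₂ T₁ T₂)))
    (p : adelic F E c N JV × (adelic F E c M₁ J₁ × adelic F E c M₂ J₂)) (Φ : piSchwartzBruhat F (Fin N × Fin (M₁ + M₂))) :
    adelicMpCont.omega F (Fin N × Fin (M₁ + M₂))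
        (TV.map (algebraMap F (AdeleRing (𝓞 F) F)) ⊗ₖ (finSum M₁ M₂ T₁ T₂).map (algebraMap F (AdeleRing (𝓞 F) F)))
        (seesawBig F E c N M₁ M₂ eW JV J₁ J₂ s p) Φ =
      (piSBReindex F eW).symm
        (adelicMpCont.omega F (Fin n) (adelicGram F eW TV (finSum M₁ M₂ T₁ T₂))
          (pairSplitting F E c N (M₁ + M₂) eW JV (finSum M₁ M₂ J₁ J₂) s (p.1, adelicBlockDiag F E c M₁ M₂ J₁ J₂ p.2))
          (piSBReindex F eW Φ)) :=
  adelicMpCont.omega_reindex_symm_apply F eW _ _ Φ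

/-- `ω(seesawSmall₁ s₁ p) Φ = R_{e₁}⁻¹ (ω(s_{1,pair}(g, u₁)) (R_{e₁} Φ))`. [folklore] -/
theorem omega_seesawSmall₁_apply (s₁ : adelicPair F E c N M₁ JV J₁ →* adelicMpCont F (Fin n₁) (adelicGram F e₁ TV T₁))
    (p : adelic F E c N JV × (adelic F E c M₁ J₁ × adelic F E c M₂ J₂)) (Φ : piSchwartzBruhat F (Fin N × Fin M₁)) :
    adelicMpCont.omega F (Fin N × Fin M₁)
        (TV.map (algebraMap F (AdeleRing (𝓞 F) F)) ⊗ₖ T₁.map (algebraMap F (AdeleRing (𝓞 F) F)))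
        (seesawSmall₁ F E c N M₁ M₂ e₁ JV J₁ J₂ s₁ p) Φ =
      (piSBReindex F e₁).symm
        (adelicMpCont.omega F (Fin n₁) (adelicGram F e₁ TV T₁) (pairSplitting F E c N M₁ e₁ JV J₁ s₁ (p.1, p.2.1))
          (piSBReindex F e₁ Φ)) :=
  adelicMpCont.omega_reindex_symm_apply F e₁ _ _ Φ

/-- `ω(seesawSmall₂ s₂ p) Φ = R_{e₂}⁻¹ (ω(s_{2,pair}(g, u₂)) (R_{e₂} Φ))`. [folklore] -/
theorem omega_seesawSmall₂_apply (s₂ : adelicPair F E c N M₂ JV J₂ →* adelicMpCont F (Fin n₂) (adelicGram F e₂ TV T₂))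
    (p : adelic F E c N JV × (adelic F E c M₁ J₁ × adelic F E c M₂ J₂)) (Φ : piSchwartzBruhat F (Fin N × Fin M₂)) :
    adelicMpCont.omega F (Fin N × Fin M₂)
        (TV.map (algebraMap F (AdeleRing (𝓞 F) F)) ⊗ₖ T₂.map (algebraMap F (AdeleRing (𝓞 F) F)))
        (seesawSmall₂ F E c N M₁ M₂ e₂ JV J₁ J₂ s₂ p) Φ =
      (piSBReindex F e₂).symm
        (adelicMpCont.omega F (Fin n₂) (adelicGram F e₂ TV T₂) (pairSplitting F E c N M₂ e₂ JV J₂ s₂ (p.1, p.2.2))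
          (piSBReindex F e₂ Φ)) :=
  adelicMpCont.omega_reindex_symm_apply F e₂ _ _ Φ

/-! ### Continuity -/

/-- `seesawBig s` is continuous along a continuous pair splitting. [folklore] -/
theorem continuous_seesawBig {s : adelicPair F E c N (M₁ + M₂) JV (finSum M₁ M₂ J₁ J₂) →*
      adelicMpCont F (Fin n) (adelicGram F eW TV (finSum M₁ M₂ T₁ T₂))}
    (hc : Continuous (pairSplitting F E c N (M₁ + M₂) eW JV (finSum M₁ M₂ J₁ J₂) s))
    (hsymm : Continuous (adelicMpContReindex F eW
      (TV.map (algebraMap F (AdeleRing (𝓞 F) F)) ⊗ₖ (finSum M₁ M₂ T₁ T₂).map (algebraMap F (AdeleRing (𝓞 F) F)))).symm) :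
    Continuous (seesawBig F E c N M₁ M₂ eW JV J₁ J₂ s) :=
  hsymm.comp (hc.comp (continuous_id.prodMap (continuous_adelicBlockDiag F E c M₁ M₂ J₁ J₂)))

end Homs

/-! ## §1b Projections and `Θ`-fixing at rational points (compatible splittings) -/

section Compatible

variable (F E : Type) [Field F] [NumberField F] [Field E] [NumberField E] [Algebra F E]
variable (c : E ≃ₐ[F] E) (N M₁ M₂ : ℕ) {n n₁ n₂ : ℕ}
  (eW : Fin N × Fin (M₁ + M₂) ≃ Fin n) (e₁ : Fin N × Fin M₁ ≃ Fin n₁) (e₂ : Fin N × Fin M₂ ≃ Fin n₂)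
variable (JV : Matrix (Fin N) (Fin N) E) (J₁ : Matrix (Fin M₁) (Fin M₁) E) (J₂ : Matrix (Fin M₂) (Fin M₂) E)
variable {TV : Matrix (Fin N) (Fin N) F} {T₁ : Matrix (Fin M₁) (Fin M₁) F} {T₂ : Matrix (Fin M₂) (Fin M₂) F}
variable [Algebra.IsQuadraticExtension F E] {δ : E} (hcδ : c δ = -δ) (hδ : δ ≠ 0) {d : F}
  (hd : δ * δ = algebraMap F E d) (hV : TV.IsSymm) (h₁ : T₁.IsSymm) (h₂ : T₂.IsSymm) (hVd : IsUnit TV.det)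
  (h₁d : IsUnit T₁.det) (h₂d : IsUnit T₂.det) (hWd : IsUnit (finSum M₁ M₂ T₁ T₂).det)
  (hJV : JV = TV.map (algebraMap F E)) (hJ₁ : J₁ = T₁.map (algebraMap F E)) (hJ₂ : J₂ = T₂.map (algebraMap F E))

omit [NumberField F] [NumberField E] [Algebra.IsQuadraticExtension F E] in
include hJ₁ hJ₂ in
/-- `J₁ ⊕ᶠ J₂ = (T₁ ⊕ᶠ T₂) ⊗ 1`. [folklore] -/
theorem finSum_eq_map_finSum : finSum M₁ M₂ J₁ J₂ = (finSum M₁ M₂ T₁ T₂).map (algebraMap F E) := by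
  rw [hJ₁, hJ₂, finSum_map]

variable {s : adelicPair F E c N (M₁ + M₂) JV (finSum M₁ M₂ J₁ J₂) →*
    adelicMpCont F (Fin n) (adelicGram F eW TV (finSum M₁ M₂ T₁ T₂))}
  {s₁ : adelicPair F E c N M₁ JV J₁ →* adelicMpCont F (Fin n₁) (adelicGram F e₁ TV T₁)}
  {s₂ : adelicPair F E c N M₂ JV J₂ →* adelicMpCont F (Fin n₂) (adelicGram F e₂ TV T₂)}

/-- **`π(seesawBig s (g, (u₁, u₂))) = ι_{V,W}(g ⊗ (u₁ ⊕ᶠ u₂))`** (unitary-2's `adelicPairToSymplectic`), for a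
compatible `s`. [cite: GelbartRogawski1991, §3.1 Prop. 3.1.1 p. 455 L1–3] -/
theorem proj_seesawBig
    (hs : (splittingDatum F E c N (M₁ + M₂) eW JV (finSum M₁ M₂ J₁ J₂) hcδ hδ hd hV (isSymm_finSum h₁ h₂) hVd hWd hJV
      (finSum_eq_map_finSum F E M₁ M₂ J₁ J₂ hJ₁ hJ₂)).IsCompatible s)
    (p : adelic F E c N JV × (adelic F E c M₁ J₁ × adelic F E c M₂ J₂)) :
    adelicMpCont.proj F (Fin N × Fin (M₁ + M₂))
        (TV.map (algebraMap F (AdeleRing (𝓞 F) F)) ⊗ₖ (finSum M₁ M₂ T₁ T₂).map (algebraMap F (AdeleRing (𝓞 F) F)))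
        (seesawBig F E c N M₁ M₂ eW JV J₁ J₂ s p) =
      adelicPairToSymplectic F E c N (M₁ + M₂) hcδ hδ hd hV (isSymm_finSum h₁ h₂) hJV
        (finSum_eq_map_finSum F E M₁ M₂ J₁ J₂ hJ₁ hJ₂)
        (dualPair (conjAdele F E c) (adelicForm E N JV) (adelicForm E (M₁ + M₂) (finSum M₁ M₂ J₁ J₂))
          (p.1, adelicBlockDiag F E c M₁ M₂ J₁ J₂ p.2)) :=
  adelicMpCont.proj_reindex_symm_eq F eW _
    ((proj_pairSplitting F E c N (M₁ + M₂) eW JV (finSum M₁ M₂ J₁ J₂) hcδ hδ hd hV (isSymm_finSum h₁ h₂) hVd hWd hJV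
        (finSum_eq_map_finSum F E M₁ M₂ J₁ J₂ hJ₁ hJ₂) hs (p.1, adelicBlockDiag F E c M₁ M₂ J₁ J₂ p.2)).trans
      (congrArg (fun x => toSp F E c N (M₁ + M₂) eW JV (finSum M₁ M₂ J₁ J₂) hcδ hδ hd hV (isSymm_finSum h₁ h₂) hJV
          (finSum_eq_map_finSum F E M₁ M₂ J₁ J₂ hJ₁ hJ₂) x)
        (adelicInl_mul_adelicInr F E c N p.1 (adelicBlockDiag F E c M₁ M₂ J₁ J₂ p.2))))

/-- **`π(seesawSmall₁ s₁ (g, (u₁, u₂))) = ι_{V,W₁}(g ⊗ u₁)`**, for a compatible `s₁`.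
[cite: GelbartRogawski1991, §3.1 Prop. 3.1.1 p. 455 L1–3] -/
theorem proj_seesawSmall₁
    (hs₁ : (splittingDatum F E c N M₁ e₁ JV J₁ hcδ hδ hd hV h₁ hVd h₁d hJV hJ₁).IsCompatible s₁)
    (p : adelic F E c N JV × (adelic F E c M₁ J₁ × adelic F E c M₂ J₂)) :
    adelicMpCont.proj F (Fin N × Fin M₁)
        (TV.map (algebraMap F (AdeleRing (𝓞 F) F)) ⊗ₖ T₁.map (algebraMap F (AdeleRing (𝓞 F) F)))
        (seesawSmall₁ F E c N M₁ M₂ e₁ JV J₁ J₂ s₁ p) =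
      adelicPairToSymplectic F E c N M₁ hcδ hδ hd hV h₁ hJV hJ₁
        (dualPair (conjAdele F E c) (adelicForm E N JV) (adelicForm E M₁ J₁) (p.1, p.2.1)) :=
  adelicMpCont.proj_reindex_symm_eq F e₁ _
    ((proj_pairSplitting F E c N M₁ e₁ JV J₁ hcδ hδ hd hV h₁ hVd h₁d hJV hJ₁ hs₁ (p.1, p.2.1)).trans
      (congrArg (fun x => toSp F E c N M₁ e₁ JV J₁ hcδ hδ hd hV h₁ hJV hJ₁ x)
        (adelicInl_mul_adelicInr F E c N p.1 p.2.1)))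

/-- **`π(seesawSmall₂ s₂ (g, (u₁, u₂))) = ι_{V,W₂}(g ⊗ u₂)`**, for a compatible `s₂`.
[cite: GelbartRogawski1991, §3.1 Prop. 3.1.1 p. 455 L1–3] -/
theorem proj_seesawSmall₂
    (hs₂ : (splittingDatum F E c N M₂ e₂ JV J₂ hcδ hδ hd hV h₂ hVd h₂d hJV hJ₂).IsCompatible s₂)
    (p : adelic F E c N JV × (adelic F E c M₁ J₁ × adelic F E c M₂ J₂)) :
    adelicMpCont.proj F (Fin N × Fin M₂)
        (TV.map (algebraMap F (AdeleRing (𝓞 F) F)) ⊗ₖ T₂.map (algebraMap F (AdeleRing (𝓞 F) F)))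
        (seesawSmall₂ F E c N M₁ M₂ e₂ JV J₁ J₂ s₂ p) =
      adelicPairToSymplectic F E c N M₂ hcδ hδ hd hV h₂ hJV hJ₂
        (dualPair (conjAdele F E c) (adelicForm E N JV) (adelicForm E M₂ J₂) (p.1, p.2.2)) :=
  adelicMpCont.proj_reindex_symm_eq F e₂ _
    ((proj_pairSplitting F E c N M₂ e₂ JV J₂ hcδ hδ hd hV h₂ hVd h₂d hJV hJ₂ hs₂ (p.1, p.2.2)).trans
      (congrArg (fun x => toSp F E c N M₂ e₂ JV J₂ hcδ hδ hd hV h₂ hJV hJ₂ x)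
        (adelicInl_mul_adelicInr F E c N p.1 p.2.2)))

/-- **`Θ`-fixing at rational points, big pair**: for `γ_V ∈ U(J_V)(F)`, `γ_j ∈ U(J_j)(F)`, the value
`seesawBig s (γ_V, (γ₁, γ₂))` is `Θ`-fixing (Weil's Thm 6 through the compatibility of `s`; `γ₁ ⊕ᶠ γ₂` is rational).
[cite: Weil1964, Chap. III n° 41 Thm 6 p. 193] -/
theorem coe_seesawBig_mem_adelicMpTheta
    (hs : (splittingDatum F E c N (M₁ + M₂) eW JV (finSum M₁ M₂ J₁ J₂) hcδ hδ hd hV (isSymm_finSum h₁ h₂) hVd hWd hJV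
      (finSum_eq_map_finSum F E M₁ M₂ J₁ J₂ hJ₁ hJ₂)).IsCompatible s)
    (γV : rational F E c N JV) (γ₁ : rational F E c M₁ J₁) (γ₂ : rational F E c M₂ J₂) :
    ((seesawBig F E c N M₁ M₂ eW JV J₁ J₂ s
        (toAdelic F E c N JV γV, (toAdelic F E c M₁ J₁ γ₁, toAdelic F E c M₂ J₂ γ₂)) :
        adelicMpCont F (Fin N × Fin (M₁ + M₂))
          (TV.map (algebraMap F (AdeleRing (𝓞 F) F)) ⊗ₖ (finSum M₁ M₂ T₁ T₂).map (algebraMap F (AdeleRing (𝓞 F) F)))) :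
        adelicMp F (Fin N × Fin (M₁ + M₂))
          (TV.map (algebraMap F (AdeleRing (𝓞 F) F)) ⊗ₖ (finSum M₁ M₂ T₁ T₂).map (algebraMap F (AdeleRing (𝓞 F) F)))) ∈
      adelicMpTheta F (Fin N × Fin (M₁ + M₂))
        (TV.map (algebraMap F (AdeleRing (𝓞 F) F)) ⊗ₖ (finSum M₁ M₂ T₁ T₂).map (algebraMap F (AdeleRing (𝓞 F) F))) :=
  (coe_adelicMpContReindex_symm_mem_adelicMpTheta_iff F eW _ _).2
    ((MpPsi.mem_fixing_iff _ _ _).2 fun Φ =>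
      thetaDistLM_pairRep_rat F E c N (M₁ + M₂) eW JV (finSum M₁ M₂ J₁ J₂) hcδ hδ hd hV (isSymm_finSum h₁ h₂) hVd hWd
        hJV (finSum_eq_map_finSum F E M₁ M₂ J₁ J₂ hJ₁ hJ₂) hs ⟨γV, rfl⟩
        (adelicBlockDiag_toAdelic_mem_range F E c M₁ M₂ J₁ J₂ γ₁ γ₂) Φ)

/-- **`Θ`-fixing at rational points, first small pair.** [cite: Weil1964, Chap. III n° 41 Thm 6 p. 193] -/
theorem coe_seesawSmall₁_mem_adelicMpTheta
    (hs₁ : (splittingDatum F E c N M₁ e₁ JV J₁ hcδ hδ hd hV h₁ hVd h₁d hJV hJ₁).IsCompatible s₁)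
    (γV : rational F E c N JV) (γ₁ : rational F E c M₁ J₁) (u₂ : adelic F E c M₂ J₂) :
    ((seesawSmall₁ F E c N M₁ M₂ e₁ JV J₁ J₂ s₁ (toAdelic F E c N JV γV, (toAdelic F E c M₁ J₁ γ₁, u₂)) :
        adelicMpCont F (Fin N × Fin M₁)
          (TV.map (algebraMap F (AdeleRing (𝓞 F) F)) ⊗ₖ T₁.map (algebraMap F (AdeleRing (𝓞 F) F)))) :
        adelicMp F (Fin N × Fin M₁)
          (TV.map (algebraMap F (AdeleRing (𝓞 F) F)) ⊗ₖ T₁.map (algebraMap F (AdeleRing (𝓞 F) F)))) ∈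
      adelicMpTheta F (Fin N × Fin M₁)
        (TV.map (algebraMap F (AdeleRing (𝓞 F) F)) ⊗ₖ T₁.map (algebraMap F (AdeleRing (𝓞 F) F))) :=
  (coe_adelicMpContReindex_symm_mem_adelicMpTheta_iff F e₁ _ _).2
    ((MpPsi.mem_fixing_iff _ _ _).2 fun Φ =>
      thetaDistLM_pairRep_rat F E c N M₁ e₁ JV J₁ hcδ hδ hd hV h₁ hVd h₁d hJV hJ₁ hs₁ ⟨γV, rfl⟩ ⟨γ₁, rfl⟩ Φ)

/-- **`Θ`-fixing at rational points, second small pair.** [cite: Weil1964, Chap. III n° 41 Thm 6 p. 193] -/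
theorem coe_seesawSmall₂_mem_adelicMpTheta
    (hs₂ : (splittingDatum F E c N M₂ e₂ JV J₂ hcδ hδ hd hV h₂ hVd h₂d hJV hJ₂).IsCompatible s₂)
    (γV : rational F E c N JV) (u₁ : adelic F E c M₁ J₁) (γ₂ : rational F E c M₂ J₂) :
    ((seesawSmall₂ F E c N M₁ M₂ e₂ JV J₁ J₂ s₂ (toAdelic F E c N JV γV, (u₁, toAdelic F E c M₂ J₂ γ₂)) :
        adelicMpCont F (Fin N × Fin M₂)
          (TV.map (algebraMap F (AdeleRing (𝓞 F) F)) ⊗ₖ T₂.map (algebraMap F (AdeleRing (𝓞 F) F)))) :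
        adelicMp F (Fin N × Fin M₂)
          (TV.map (algebraMap F (AdeleRing (𝓞 F) F)) ⊗ₖ T₂.map (algebraMap F (AdeleRing (𝓞 F) F)))) ∈
      adelicMpTheta F (Fin N × Fin M₂)
        (TV.map (algebraMap F (AdeleRing (𝓞 F) F)) ⊗ₖ T₂.map (algebraMap F (AdeleRing (𝓞 F) F))) :=
  (coe_adelicMpContReindex_symm_mem_adelicMpTheta_iff F e₂ _ _).2
    ((MpPsi.mem_fixing_iff _ _ _).2 fun Φ =>
      thetaDistLM_pairRep_rat F E c N M₂ e₂ JV J₂ hcδ hδ hd hV h₂ hVd h₂d hJV hJ₂ hs₂ ⟨γV, rfl⟩ ⟨γ₂, rfl⟩ Φ)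

/-! ## §2 The see-saw hypothesis and the character -/

/-- the Gram identity along `finProdSumEquiv`: `reindex (T_V ⊗ (T₁ ⊕ᶠ T₂) ⊗ 1) = (T_V ⊗ T₁ ⊗ 1) ⊕ (T_V ⊗ T₂ ⊗ 1)`.
[folklore] -/
theorem reindex_gram_finSum :
    Matrix.reindex (finProdSumEquiv N M₁ M₂) (finProdSumEquiv N M₁ M₂)
        (TV.map (algebraMap F (AdeleRing (𝓞 F) F)) ⊗ₖ (finSum M₁ M₂ T₁ T₂).map (algebraMap F (AdeleRing (𝓞 F) F))) =
      Matrix.fromBlocks (TV.map (algebraMap F (AdeleRing (𝓞 F) F)) ⊗ₖ T₁.map (algebraMap F (AdeleRing (𝓞 F) F))) 0 0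
        (TV.map (algebraMap F (AdeleRing (𝓞 F) F)) ⊗ₖ T₂.map (algebraMap F (AdeleRing (𝓞 F) F))) := by
  rw [finSum_map]
  exact reindex_kronecker_finSum _ _ _

/-- `T_V ⊗ T_j ⊗ 1` is an invertible matrix. [folklore] -/
theorem isUnit_kronecker_map {M : ℕ} {TW : Matrix (Fin M) (Fin M) F} (hVd : IsUnit TV.det) (hWd : IsUnit TW.det) :
    IsUnit (TV.map (algebraMap F (AdeleRing (𝓞 F) F)) ⊗ₖ TW.map (algebraMap F (AdeleRing (𝓞 F) F))) :=
  (Matrix.isUnit_iff_isUnit_det _).2 (by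
    rw [kronecker_map_map, ← RingHom.mapMatrix_apply, ← RingHom.map_det]
    exact (SpTransport.isUnit_det_kronecker hVd hWd).map _)

/-- **THE SEE-SAW HYPOTHESIS `hS` at the splitting data of record**: read through `finProdSumEquiv N M₁ M₂`,
`π(seesawBig s p) = π(seesawSmall₁ s₁ p) ⊕ π(seesawSmall₂ s₂ p)` — unitary-2's
`adelicPairToSymplectic_dualPair_adelicBlockDiag`. [cite: Kudla1984, §1] -/
theorem hS_seesaw
    (hs : (splittingDatum F E c N (M₁ + M₂) eW JV (finSum M₁ M₂ J₁ J₂) hcδ hδ hd hV (isSymm_finSum h₁ h₂) hVd hWd hJV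
      (finSum_eq_map_finSum F E M₁ M₂ J₁ J₂ hJ₁ hJ₂)).IsCompatible s)
    (hs₁ : (splittingDatum F E c N M₁ e₁ JV J₁ hcδ hδ hd hV h₁ hVd h₁d hJV hJ₁).IsCompatible s₁)
    (hs₂ : (splittingDatum F E c N M₂ e₂ JV J₂ hcδ hδ hd hV h₂ hVd h₂d hJV hJ₂).IsCompatible s₂)
    (p : adelic F E c N JV × (adelic F E c M₁ J₁ × adelic F E c M₂ J₂)) :
    (spReindex (finProdSumEquiv N M₁ M₂)
        (TV.map (algebraMap F (AdeleRing (𝓞 F) F)) ⊗ₖ (finSum M₁ M₂ T₁ T₂).map (algebraMap F (AdeleRing (𝓞 F) F)))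
        (adelicMpCont.proj F (Fin N × Fin (M₁ + M₂))
          (TV.map (algebraMap F (AdeleRing (𝓞 F) F)) ⊗ₖ (finSum M₁ M₂ T₁ T₂).map (algebraMap F (AdeleRing (𝓞 F) F)))
          (seesawBig F E c N M₁ M₂ eW JV J₁ J₂ s p))).1 =
      (spSum (TV.map (algebraMap F (AdeleRing (𝓞 F) F)) ⊗ₖ T₁.map (algebraMap F (AdeleRing (𝓞 F) F)))
        (TV.map (algebraMap F (AdeleRing (𝓞 F) F)) ⊗ₖ T₂.map (algebraMap F (AdeleRing (𝓞 F) F)))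
        (adelicMpCont.proj F (Fin N × Fin M₁)
            (TV.map (algebraMap F (AdeleRing (𝓞 F) F)) ⊗ₖ T₁.map (algebraMap F (AdeleRing (𝓞 F) F)))
            (seesawSmall₁ F E c N M₁ M₂ e₁ JV J₁ J₂ s₁ p),
          adelicMpCont.proj F (Fin N × Fin M₂)
            (TV.map (algebraMap F (AdeleRing (𝓞 F) F)) ⊗ₖ T₂.map (algebraMap F (AdeleRing (𝓞 F) F)))
            (seesawSmall₂ F E c N M₁ M₂ e₂ JV J₁ J₂ s₂ p))).1 :=
  ((congrArg (fun x => (spReindex (finProdSumEquiv N M₁ M₂)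
      (TV.map (algebraMap F (AdeleRing (𝓞 F) F)) ⊗ₖ (finSum M₁ M₂ T₁ T₂).map (algebraMap F (AdeleRing (𝓞 F) F))) x).1)
      (proj_seesawBig F E c N M₁ M₂ eW JV J₁ J₂ hcδ hδ hd hV h₁ h₂ hVd hWd hJV hJ₁ hJ₂ hs p)).trans
    (adelicPairToSymplectic_dualPair_adelicBlockDiag F E c N M₁ M₂ hcδ hδ hd hV h₁ h₂ hJV hJ₁ hJ₂ p.1 p.2)).trans
    (congrArg₂ (fun x y => (spSum (TV.map (algebraMap F (AdeleRing (𝓞 F) F)) ⊗ₖ T₁.map (algebraMap F (AdeleRing (𝓞 F) F)))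
        (TV.map (algebraMap F (AdeleRing (𝓞 F) F)) ⊗ₖ T₂.map (algebraMap F (AdeleRing (𝓞 F) F))) (x, y)).1)
      (proj_seesawSmall₁ F E c N M₁ M₂ e₁ JV J₁ J₂ hcδ hδ hd hV h₁ hVd h₁d hJV hJ₁ hs₁ p).symm
      (proj_seesawSmall₂ F E c N M₁ M₂ e₂ JV J₁ J₂ hcδ hδ hd hV h₂ hVd h₂d hJV hJ₂ hs₂ p).symm)

/-- **THE `(12)` SEE-SAW CHARACTER AT THE SPLITTING DATA OF RECORD** `χ₁₂ : U(J_V)(𝔸) × (U(J₁)(𝔸) × U(J₂)(𝔸)) →* ℂˣ`: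
`mpSeesawCharSum` along `finProdSumEquiv N M₁ M₂` of `seesawBig s` against `seesawSmall₁ s₁`, `seesawSmall₂ s₂`.
(cf. R. Howe (1979) §3; S. Kudla (1984) §1; S. Gelbart–J. Rogawski (1991) §3.1 Remark p. 457) [folklore] -/
def mpSeesawChar₁₂
    (hs : (splittingDatum F E c N (M₁ + M₂) eW JV (finSum M₁ M₂ J₁ J₂) hcδ hδ hd hV (isSymm_finSum h₁ h₂) hVd hWd hJV
      (finSum_eq_map_finSum F E M₁ M₂ J₁ J₂ hJ₁ hJ₂)).IsCompatible s)
    (hs₁ : (splittingDatum F E c N M₁ e₁ JV J₁ hcδ hδ hd hV h₁ hVd h₁d hJV hJ₁).IsCompatible s₁)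
    (hs₂ : (splittingDatum F E c N M₂ e₂ JV J₂ hcδ hδ hd hV h₂ hVd h₂d hJV hJ₂).IsCompatible s₂) :
    adelic F E c N JV × (adelic F E c M₁ J₁ × adelic F E c M₂ J₂) →* ℂˣ :=
  mpSeesawCharSum (finProdSumEquiv N M₁ M₂) (reindex_gram_finSum F N M₁ M₂)
    (seesawBig F E c N M₁ M₂ eW JV J₁ J₂ s) (seesawSmall₁ F E c N M₁ M₂ e₁ JV J₁ J₂ s₁)
    (seesawSmall₂ F E c N M₁ M₂ e₂ JV J₁ J₂ s₂)
    (hS_seesaw F E c N M₁ M₂ eW e₁ e₂ JV J₁ J₂ hcδ hδ hd hV h₁ h₂ hVd h₁d h₂d hWd hJV hJ₁ hJ₂ hs hs₁ hs₂)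
    (isUnit_kronecker_map F N hVd h₁d) (isUnit_kronecker_map F N hVd h₂d)

/-- By definition `mpSeesawChar₁₂ … = mpSeesawCharSum (finProdSumEquiv N M₁ M₂) _ (seesawBig s) (seesawSmall₁ s₁)
(seesawSmall₂ s₂) …` — so all of `AdelicMetaplecticSeesawSum` / `AdelicMetaplecticSeesawCharacter` applies. [folklore] -/
theorem mpSeesawChar₁₂_def
    (hs : (splittingDatum F E c N (M₁ + M₂) eW JV (finSum M₁ M₂ J₁ J₂) hcδ hδ hd hV (isSymm_finSum h₁ h₂) hVd hWd hJV
      (finSum_eq_map_finSum F E M₁ M₂ J₁ J₂ hJ₁ hJ₂)).IsCompatible s)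
    (hs₁ : (splittingDatum F E c N M₁ e₁ JV J₁ hcδ hδ hd hV h₁ hVd h₁d hJV hJ₁).IsCompatible s₁)
    (hs₂ : (splittingDatum F E c N M₂ e₂ JV J₂ hcδ hδ hd hV h₂ hVd h₂d hJV hJ₂).IsCompatible s₂) :
    mpSeesawChar₁₂ F E c N M₁ M₂ eW e₁ e₂ JV J₁ J₂ hcδ hδ hd hV h₁ h₂ hVd h₁d h₂d hWd hJV hJ₁ hJ₂ hs hs₁ hs₂ =
      mpSeesawCharSum (finProdSumEquiv N M₁ M₂) (reindex_gram_finSum F N M₁ M₂)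
        (seesawBig F E c N M₁ M₂ eW JV J₁ J₂ s) (seesawSmall₁ F E c N M₁ M₂ e₁ JV J₁ J₂ s₁)
        (seesawSmall₂ F E c N M₁ M₂ e₂ JV J₁ J₂ s₂)
        (hS_seesaw F E c N M₁ M₂ eW e₁ e₂ JV J₁ J₂ hcδ hδ hd hV h₁ h₂ hVd h₁d h₂d hWd hJV hJ₁ hJ₂ hs hs₁ hs₂)
        (isUnit_kronecker_map F N hVd h₁d) (isUnit_kronecker_map F N hVd h₂d) :=
  rfl

/-- **The `(12)` restriction identity of the oscillator representation** (Kronecker coordinates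
`Fin N × Fin (M₁ + M₂)`): `ω(s_pair(g, u₁ ⊕ᶠ u₂)) (Φ₁ ⊠ Φ₂) = χ₁₂(g, (u₁, u₂)) • (ω(s_{1,pair}(g, u₁)) Φ₁ ⊠ ω(s_{2,pair}(g, u₂)) Φ₂)`,
the tensor read through `finProdSumEquiv` (`sumTensor`). (cf. R. Howe (1979) §3; S. Kudla (1984) §1) [folklore] -/
theorem mpSeesawChar₁₂_spec
    (hs : (splittingDatum F E c N (M₁ + M₂) eW JV (finSum M₁ M₂ J₁ J₂) hcδ hδ hd hV (isSymm_finSum h₁ h₂) hVd hWd hJV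
      (finSum_eq_map_finSum F E M₁ M₂ J₁ J₂ hJ₁ hJ₂)).IsCompatible s)
    (hs₁ : (splittingDatum F E c N M₁ e₁ JV J₁ hcδ hδ hd hV h₁ hVd h₁d hJV hJ₁).IsCompatible s₁)
    (hs₂ : (splittingDatum F E c N M₂ e₂ JV J₂ hcδ hδ hd hV h₂ hVd h₂d hJV hJ₂).IsCompatible s₂)
    (p : adelic F E c N JV × (adelic F E c M₁ J₁ × adelic F E c M₂ J₂))
    (Φ₁ : piSchwartzBruhat F (Fin N × Fin M₁)) (Φ₂ : piSchwartzBruhat F (Fin N × Fin M₂)) :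
    adelicMpCont.omega F (Fin N × Fin (M₁ + M₂))
        (TV.map (algebraMap F (AdeleRing (𝓞 F) F)) ⊗ₖ (finSum M₁ M₂ T₁ T₂).map (algebraMap F (AdeleRing (𝓞 F) F)))
        (seesawBig F E c N M₁ M₂ eW JV J₁ J₂ s p) (sumTensor F (finProdSumEquiv N M₁ M₂) Φ₁ Φ₂) =
      (mpSeesawChar₁₂ F E c N M₁ M₂ eW e₁ e₂ JV J₁ J₂ hcδ hδ hd hV h₁ h₂ hVd h₁d h₂d hWd hJV hJ₁ hJ₂ hs hs₁ hs₂ p : ℂ) •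
        sumTensor F (finProdSumEquiv N M₁ M₂)
          (adelicMpCont.omega F (Fin N × Fin M₁)
            (TV.map (algebraMap F (AdeleRing (𝓞 F) F)) ⊗ₖ T₁.map (algebraMap F (AdeleRing (𝓞 F) F)))
            (seesawSmall₁ F E c N M₁ M₂ e₁ JV J₁ J₂ s₁ p) Φ₁)
          (adelicMpCont.omega F (Fin N × Fin M₂)
            (TV.map (algebraMap F (AdeleRing (𝓞 F) F)) ⊗ₖ T₂.map (algebraMap F (AdeleRing (𝓞 F) F)))
            (seesawSmall₂ F E c N M₁ M₂ e₂ JV J₁ J₂ s₂ p) Φ₂) :=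
  mpSeesawCharSum_spec (finProdSumEquiv N M₁ M₂) (reindex_gram_finSum F N M₁ M₂) _ _ _
    (hS_seesaw F E c N M₁ M₂ eW e₁ e₂ JV J₁ J₂ hcδ hδ hd hV h₁ h₂ hVd h₁d h₂d hWd hJV hJ₁ hJ₂ hs hs₁ hs₂) _ _ p Φ₁ Φ₂

/-- **`χ₁₂ = 1` ON RATIONAL POINTS**: the three compatible splittings differ on the see-saw by an AUTOMORPHIC
character ([GelbartRogawski1991, §3.1 Remark p. 457] in kernel form; Weil's Thm 6 at the three rational values).
[cite: Weil1964, Chap. III n° 41 Thm 6 p. 193] -/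
theorem mpSeesawChar₁₂_eq_one_of_rational
    (hs : (splittingDatum F E c N (M₁ + M₂) eW JV (finSum M₁ M₂ J₁ J₂) hcδ hδ hd hV (isSymm_finSum h₁ h₂) hVd hWd hJV
      (finSum_eq_map_finSum F E M₁ M₂ J₁ J₂ hJ₁ hJ₂)).IsCompatible s)
    (hs₁ : (splittingDatum F E c N M₁ e₁ JV J₁ hcδ hδ hd hV h₁ hVd h₁d hJV hJ₁).IsCompatible s₁)
    (hs₂ : (splittingDatum F E c N M₂ e₂ JV J₂ hcδ hδ hd hV h₂ hVd h₂d hJV hJ₂).IsCompatible s₂)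
    (γV : rational F E c N JV) (γ₁ : rational F E c M₁ J₁) (γ₂ : rational F E c M₂ J₂) :
    mpSeesawChar₁₂ F E c N M₁ M₂ eW e₁ e₂ JV J₁ J₂ hcδ hδ hd hV h₁ h₂ hVd h₁d h₂d hWd hJV hJ₁ hJ₂ hs hs₁ hs₂
        (toAdelic F E c N JV γV, (toAdelic F E c M₁ J₁ γ₁, toAdelic F E c M₂ J₂ γ₂)) = 1 :=
  mpSeesawCharSum_eq_one_of_mem_adelicMpTheta (finProdSumEquiv N M₁ M₂) (reindex_gram_finSum F N M₁ M₂) _ _ _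
    (hS_seesaw F E c N M₁ M₂ eW e₁ e₂ JV J₁ J₂ hcδ hδ hd hV h₁ h₂ hVd h₁d h₂d hWd hJV hJ₁ hJ₂ hs hs₁ hs₂) _ _
    (coe_seesawBig_mem_adelicMpTheta F E c N M₁ M₂ eW JV J₁ J₂ hcδ hδ hd hV h₁ h₂ hVd hWd hJV hJ₁ hJ₂ hs γV γ₁ γ₂)
    (coe_seesawSmall₁_mem_adelicMpTheta F E c N M₁ M₂ e₁ JV J₁ J₂ hcδ hδ hd hV h₁ hVd h₁d hJV hJ₁ hs₁ γV γ₁ _)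
    (coe_seesawSmall₂_mem_adelicMpTheta F E c N M₁ M₂ e₂ JV J₁ J₂ hcδ hδ hd hV h₂ hVd h₂d hJV hJ₂ hs₂ γV _ γ₂)

end Compatible

/-! ### Build-lane note (ops-buildfix G11b-3 recipe, LEDGER B13-1, 2026-08-21)
`lean -o` (the hub build lane, never `lean`/the gate check) runs Lean 4.32's library-suggestion indexers
(`Lean.LibrarySuggestions.SymbolFrequency` / `SineQuaNon`, from their `exportEntriesFn`) over the statement of
every local theorem that is not a denied premise; on this family's statements (very large dependent binder
telescopes through the theta-kernel / dual-pair data) that fold runs for tens of minutes to hours and the build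
lane kills the job (incident G11b-3, run/shared/lean/ops/buildfix/G11b-3-DOSSIER.md). `isDeniedPremise` skips
`[implicit_reducible]` constants before any fold, and a reducibility status on a *theorem* is inert (Meta never
unfolds `thmInfo`; the kernel ignores the attribute), so the public theorems of this file are tagged
`[implicit_reducible]` purely to keep them out of that index. Only other effect: they are not offered by
`+suggestions` premise selectors. No statement or proof is changed; superseded if the operator lands a
deny-list form (`HarnessLib.PremiseIndex`). -/
set_option allowUnsafeReducibility true in
attribute [implicit_reducible]
  seesawBig_apply seesawSmall₁_apply seesawSmall₂_apply omega_seesawBig_apply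
  omega_seesawSmall₁_apply omega_seesawSmall₂_apply continuous_seesawBig finSum_eq_map_finSum
  proj_seesawBig proj_seesawSmall₁ proj_seesawSmall₂ coe_seesawBig_mem_adelicMpTheta
  coe_seesawSmall₁_mem_adelicMpTheta coe_seesawSmall₂_mem_adelicMpTheta reindex_gram_finSum
  isUnit_kronecker_map hS_seesaw mpSeesawChar₁₂_def mpSeesawChar₁₂_spec
  mpSeesawChar₁₂_eq_one_of_rational

end UnitaryDualPair

end Literature.NumberTheory.GelbartRogawski1991

end
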